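import Summits.ResolutionOfSingularities.ResolutionOfSingularities.Theorems.EquisingularLiftEquisingularLiftNatNoseRoundStageOfModel
import Summits.ResolutionOfSingularities.ResolutionOfSingularities.Theorems.EquisingularLiftEquisingularLiftNatTowerExcFourEmpty
import HarnessLib

/-!
# [OURS · L1 W4.5(b) · EL♮(3) · WIDTH TABLE D17 «STAGE-0 TOWER BOOKKEEPING», engine (n3)] THE SEED OF THE STAGE-0 TOWER: `Tower.invB₄_seed_stage0`
# — the engine invariant `INV₀ := InvB₄ FE … ∧ K-side facts` holds at `(ℙ³_k, 𝟙, range ι, ∅, [], [], ∅)` over the initial upstairs stage `(ℙ³_O, 𝟙)`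

res-L1-w45b-nose-w1 g7 (WIDTH seat D-0157 DOOR 1; desk RULING R82 (A) «nose-w1 g7: TAKE (n3) SEED `Tower.invB₄_seed_stage0` (S0-a …)»; sizing res-L1-w45b-idea-2 g31
`D17-SIZING-idea2.md` c53e9159a56ae8bd (E-a); door ✓ res-type-027 DefsE9 p719436 `ReachTowerNose₀` seeds its motive at `R ℙ³ (𝟙 _) T₁ ∅ [] [] ∅`).
WHAT.  The D17 door τ0 starts the B-tower AT THE INITIAL STAGE with NO nose blow-up, host `∅`, empty member lists and shadow `∅`.  Upstairs the engine's
motive is `INV₀ G γ T E Es Ns K := InvB₄ FE F₉ Z₉ hZ₉ ℙ³_k υ' G γ T E Es Ns K ∧ IsClosed K ∧ K ⊆ closure (K ∖ E) ∧ K ≠ univ` (= `INV₁‴` of ✓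
`Tower.towerPtRamB₄_invB₁_FE` minus the carrier-dimension/Noetherian riders), and this file proves it AT THE SEED: the upstairs stage is `(ℙ³_O, 𝟙, Y, Proj φ, t)`
(base model square ✓ `ProjectiveAmbientFibre.isPullback_projMap`, dominance, ✓ `hendBlock_stage_zero_of_model`'s bytes), the EMPTY running surface carries the model
`⊤` by ✓ `Tower.exc₄_empty_FE` (…NatTowerExcFourEmpty, p712010), the lists are empty, the shadow `∅`.  CARRIER (S0-a): `InvB₄` still carries the B‴ carrier letters
`IsBlowup υ' 𝓘⟨Z₉⟩ ∧ Z₉.Infinite` (read by NO step of the stage-0 tower — res-L1-w45b-stub-4 PS-E); they enter here as HYPOTHESES on an arbitrary DUMMY datum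
`(F₉, Z₉, υ' : ℙ³_k ⟶ F₉)`, so the driver (n5) may pick any (e.g. `(ℙ³_k, V₊(x₀), 𝟙)` via Literature ✓ `IsBlowup.id` once an import-clean
`IsEffectiveCartier 𝓘⟨V₊(x₀)⟩` is at hand, or the desk's (S0-b) carrier-free twin) — this file is import-clean (hygiene (F-iv): no `Hironaka2017/Proofs` import).
OURS; NOT a statement of any manuscript ([Hironaka2017] is a candidate under adjudication, nothing of it is asserted); AI-written, weaker than expert review.
DEF-FREE; no `sorry`; standard axioms.  `--kind proof --supports stmt-ResolutionOfSingularities-20148 --as helper`, counted 0.  EL♮(3) is NOT proved here.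
[folklore; pure bookkeeping over ✓ modules]
-/

set_option linter.dupNamespace false -- mandated namespace `Summit.<Summit>.<Problem>` of this single-conjunct summit
set_option linter.overlappingInstances false -- signatures carry `[IsDomain O] [IsDiscreteValuationRing O]`

noncomputable section

open CategoryTheory CategoryTheory.Limits AlgebraicGeometry TopologicalSpace Topology IsLocalRing
open MvPolynomial
open Literature.AlgebraicGeometry.Resolution
open AlgebraicGeometry.Scheme.IdealSheafData
open Summit.ResolutionOfSingularities.ResolutionOfSingularities.Theses.EquisingularLift.Split
open Summit.ResolutionOfSingularities.ResolutionOfSingularities.Cruxes.EquisingularLift.StrataSplit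

namespace Summit.ResolutionOfSingularities.ResolutionOfSingularities.Cruxes.EquisingularLiftNat.Sections

/-- ★ **THE SEED OF THE STAGE-0 TOWER** (D17 engine (n3)): at the initial upstairs stage `(ℙ³_O, 𝟙, Y, Proj φ, t)` of the K5 engines the motive
`INV₀ := InvB₄ FE F₉ Z₉ hZ₉ ℙ³_k υ' · ∧ IsClosed K ∧ K ⊆ closure (K ∖ E) ∧ K ≠ univ` holds at `(G, γ, T, E, Es, Ns, K) := (ℙ³_k, 𝟙, range ι, ∅, [], [], ∅)`, for ANY
dummy carrier datum `(F₉, Z₉, υ')` with `IsBlowup υ' 𝓘⟨Z₉⟩`, `Z₉` infinite.  Empty running surface modelled by `⊤` (✓ `Tower.exc₄_empty_FE`).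
[OURS · L1 W4.5b · D17 engine seed; counted 0; EL♮(3) NOT proved] -/
theorem Tower.invB₄_seed_stage0 (k : Type) [Field k] [IsAlgClosed k] (H : Scheme.{0})
    (ι : H ⟶ (Literature.AlgebraicGeometry.Motives.projectiveSpace 3 k).left)
    (hι : AlgebraicGeometry.IsClosedImmersion ι) (hH : AlgebraicGeometry.IsIntegral H)
    (O : Type) [CommRing O] [IsDomain O] [IsDiscreteValuationRing O] (θ : O →+* k) (hθ : Function.Surjective θ) :
    letI := MvPolynomial.gradedAlgebra (σ := Fin (3 + 1)) (R := O); letI := MvPolynomial.gradedAlgebra (σ := Fin (3 + 1)) (R := k);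
    ∀ (φ : MvPolynomial.homogeneousSubmodule (Fin (3 + 1)) O →+*ᵍ MvPolynomial.homogeneousSubmodule (Fin (3 + 1)) k)
      (hφ' : HomogeneousIdeal.irrelevant (MvPolynomial.homogeneousSubmodule (Fin (3 + 1)) k) ≤ (HomogeneousIdeal.irrelevant (MvPolynomial.homogeneousSubmodule (Fin (3 + 1)) O)).map φ), (∀ s, φ s = MvPolynomial.map θ s) →
    ∀ (Ch : ∀ X' : AlgebraicGeometry.Scheme.{0}, (X' ⟶ (AlgebraicGeometry.Proj (MvPolynomial.homogeneousSubmodule (Fin (3 + 1)) O))) → Set X' → Prop),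
      AlgebraicGeometry.IsIntegral (AlgebraicGeometry.Proj (MvPolynomial.homogeneousSubmodule (Fin (3 + 1)) O)) → IsLocallyNoetherian (AlgebraicGeometry.Proj (MvPolynomial.homogeneousSubmodule (Fin (3 + 1)) O)) → Literature.AlgebraicGeometry.Resolution.Scheme.IsRegular (AlgebraicGeometry.Proj (MvPolynomial.homogeneousSubmodule (Fin (3 + 1)) O)) →
      -- the INITIAL stage is in the chain
      Ch (AlgebraicGeometry.Proj (MvPolynomial.homogeneousSubmodule (Fin (3 + 1)) O)) (𝟙 (AlgebraicGeometry.Proj (MvPolynomial.homogeneousSubmodule (Fin (3 + 1)) O))) (Set.range (ι ≫ AlgebraicGeometry.Proj.map φ hφ' : H ⟶ (AlgebraicGeometry.Proj (MvPolynomial.homogeneousSubmodule (Fin (3 + 1)) O)))) →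
    -- the DUMMY CARRIER of the stage-0 tower (never rounded along; any blow-up datum with an infinite closed centre — (S0-a))
    ∀ (F₉ : Scheme.{0}) (Z₉ : Set F₉) (hZ₉ : IsClosed Z₉) (υ' : (Literature.AlgebraicGeometry.Motives.projectiveSpace 3 k).left ⟶ F₉),
      IsBlowup υ' (vanishingIdeal (⟨Z₉, hZ₉⟩ : Closeds F₉)) → Z₉.Infinite →
    Tower.InvB₄ O k θ (AlgebraicGeometry.Proj (MvPolynomial.homogeneousSubmodule (Fin (3 + 1)) O)) (AlgebraicGeometry.Proj.toSpecZero (MvPolynomial.homogeneousSubmodule (Fin (3 + 1)) O) ≫ AlgebraicGeometry.Spec.map (CommRingCat.ofHom (algebraMap O (MvPolynomial.homogeneousSubmodule (Fin (3 + 1)) O 0)))) (Set.range (ι ≫ AlgebraicGeometry.Proj.map φ hφ' : H ⟶ (AlgebraicGeometry.Proj (MvPolynomial.homogeneousSubmodule (Fin (3 + 1)) O)))) Ch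
        (fun _ _ _ _ _ _ _ _ _ σ _ 𝓔 => Flat (𝓔.subschemeι ≫ σ ≫ (AlgebraicGeometry.Proj.toSpecZero (MvPolynomial.homogeneousSubmodule (Fin (3 + 1)) O) ≫ AlgebraicGeometry.Spec.map (CommRingCat.ofHom (algebraMap O (MvPolynomial.homogeneousSubmodule (Fin (3 + 1)) O 0))))))
        F₉ Z₉ hZ₉ (Literature.AlgebraicGeometry.Motives.projectiveSpace 3 k).left υ' (Literature.AlgebraicGeometry.Motives.projectiveSpace 3 k).left (𝟙 _) (Set.range ι) ∅ [] [] ∅ ∧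
      IsClosed (∅ : Set (Literature.AlgebraicGeometry.Motives.projectiveSpace 3 k).left) ∧ (∅ : Set (Literature.AlgebraicGeometry.Motives.projectiveSpace 3 k).left) ⊆ closure (∅ \ ∅) ∧ (∅ : Set (Literature.AlgebraicGeometry.Motives.projectiveSpace 3 k).left) ≠ Set.univ := by
  classical
  letI := MvPolynomial.gradedAlgebra (σ := Fin (3 + 1)) (R := O)
  letI := MvPolynomial.gradedAlgebra (σ := Fin (3 + 1)) (R := k)
  intro φ hφ' hφ Ch hPint hPnoeth hPreg hCh₀ F₉ Z₉ hZ₉ υ' hυ' hZ₉inf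
  haveI := hι
  haveI := hH
  -- the base model square and dominance of the initial stage (✓ `hendBlock_stage_zero_of_model`'s bytes)
  have hP := ProjectiveAmbientFibre.isPullback_projMap θ φ hφ hθ hφ'
  have hsq₀ : IsPullback (AlgebraicGeometry.Proj.map φ hφ') (Proj.toSpecZero (homogeneousSubmodule (Fin (3 + 1)) k) ≫
      Spec.map (CommRingCat.ofHom (algebraMap k (homogeneousSubmodule (Fin (3 + 1)) k 0))))
      (𝟙 _ ≫ (AlgebraicGeometry.Proj.toSpecZero (MvPolynomial.homogeneousSubmodule (Fin (3 + 1)) O) ≫ AlgebraicGeometry.Spec.map (CommRingCat.ofHom (algebraMap O (MvPolynomial.homogeneousSubmodule (Fin (3 + 1)) O 0))))) (Spec.map (CommRingCat.ofHom θ)) := by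
    rw [Category.id_comp]; exact hP
  obtain ⟨hsm, -⟩ := stub_projectiveAmbientSmoothProper O 3
  haveI : Nonempty H := inferInstance
  haveI : Nonempty (Literature.AlgebraicGeometry.Motives.projectiveSpace 3 k).left := ⟨ι (Classical.arbitrary H)⟩
  haveI : Nonempty (Proj (homogeneousSubmodule (Fin (3 + 1)) O)) := ⟨(AlgebraicGeometry.Proj.map φ hφ') (ι (Classical.arbitrary H))⟩
  haveI : Smooth (AlgebraicGeometry.Proj.toSpecZero (MvPolynomial.homogeneousSubmodule (Fin (3 + 1)) O) ≫ AlgebraicGeometry.Spec.map (CommRingCat.ofHom (algebraMap O (MvPolynomial.homogeneousSubmodule (Fin (3 + 1)) O 0)))) := hsm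
  haveI : IsDominant (AlgebraicGeometry.Proj.toSpecZero (MvPolynomial.homogeneousSubmodule (Fin (3 + 1)) O) ≫ AlgebraicGeometry.Spec.map (CommRingCat.ofHom (algebraMap O (MvPolynomial.homogeneousSubmodule (Fin (3 + 1)) O 0)))) := isDominant_of_smooth_of_nonempty _
  have hdom₀ : IsDominant (𝟙 (Proj (homogeneousSubmodule (Fin (3 + 1)) O)) ≫ (AlgebraicGeometry.Proj.toSpecZero (MvPolynomial.homogeneousSubmodule (Fin (3 + 1)) O) ≫ AlgebraicGeometry.Spec.map (CommRingCat.ofHom (algebraMap O (MvPolynomial.homogeneousSubmodule (Fin (3 + 1)) O 0))))) := by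
    rw [Category.id_comp]; infer_instance
  have hirrι : IsIrreducible (Set.range ι) := by
    have h := (IrreducibleSpace.isIrreducible_univ H).image ι ι.continuous.continuousOn
    rwa [Set.image_univ] at h
  have hrange : (AlgebraicGeometry.Proj.map φ hφ') '' Set.range ι =
      Set.range (ι ≫ AlgebraicGeometry.Proj.map φ hφ' : H ⟶ (AlgebraicGeometry.Proj (MvPolynomial.homogeneousSubmodule (Fin (3 + 1)) O))) := by
    rw [← Set.range_comp]; rfl
  have hTne : ¬ (Set.range ι ⊆ (∅ : Set (Literature.AlgebraicGeometry.Motives.projectiveSpace 3 k).left)) := fun h => h ⟨Classical.arbitrary H, rfl⟩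
  refine ⟨⟨hυ', hZ₉inf, isIntegral_proj_homogeneousSubmodule 3 k, ι.isClosedEmbedding.isClosed_range, hirrι, isClosed_empty, hTne,
    fun F hF => by simp at hF, fun F hF => by simp at hF,
    _, 𝟙 _, _, AlgebraicGeometry.Proj.map φ hφ', _, hCh₀, hPint, hPnoeth, hPreg, hdom₀, hsq₀, hrange, ?_, fun F hF => by simp at hF⟩,
    isClosed_empty, Set.empty_subset _, Set.empty_ne_univ⟩
  intro hE
  exact Tower.exc₄_empty_FE O (AlgebraicGeometry.Proj (MvPolynomial.homogeneousSubmodule (Fin (3 + 1)) O)) (AlgebraicGeometry.Proj.toSpecZero (MvPolynomial.homogeneousSubmodule (Fin (3 + 1)) O) ≫ AlgebraicGeometry.Spec.map (CommRingCat.ofHom (algebraMap O (MvPolynomial.homogeneousSubmodule (Fin (3 + 1)) O 0)))) (Set.range (ι ≫ AlgebraicGeometry.Proj.map φ hφ' : H ⟶ (AlgebraicGeometry.Proj (MvPolynomial.homogeneousSubmodule (Fin (3 + 1)) O)))) Z₉ hZ₉ υ' (Literature.AlgebraicGeometry.Motives.projectiveSpace 3 k).left (𝟙 _) hE _ (𝟙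 _) (AlgebraicGeometry.Proj.map φ hφ')

end Summit.ResolutionOfSingularities.ResolutionOfSingularities.Cruxes.EquisingularLiftNat.Sections

end
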